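import Summits.QuantumFields.BalabanUV.Beta.NVertexColumnK1RowTorus

/-!
# `BalabanUV.Beta.NVertexLamFold` — row D1 ∕ (C1) OWNER an2 (gen 63), PART 25: **(J-Λ-fold) — THE TORUS COLUMN TIMES THE SLOT-PERIODISED TRANSPORTED COEFFICIENT,
# SUMMED OVER THE TORUS BONDS, IS THE SLOT-PERIODISED TRANSPORTED RESPONSE (γ = 1)**: for tori `T i = Lc·T′ i`, `T′ i = Lc^j·T″ i` (the wrapper's finest torus, its
# `Ma (n+1)` and `Mc B`; `L = Lc^(j+1)`, so `T i = L·T″ i`), every source `(μ₀, y₀)` and every lower slot `(κ, s)`: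
# `Σ_{ā : pbox T × Fin 4} perF T (AN R j) (ā♭, (wrapPt T (L•y₀), inr μ₀)) · (Σ'_m cf κ (translate T′ s m) ā.2 ā.1) = Σ'_m λ′ᴿ_j (κ, translate T′ s m)`,
# `cf κ s κ′ u := Σ_ν Σ'_w lamCoeffOf (KInv L) L ν w κ′ u·compLinKer ℓ Lc j (κ,s) (ν,w)` (J-NOTE-1 (b)'s `cf (n+1)`) — road FP g40's W-1 l.67476 «(J-Λ-fold)», the row's W-3

HONEST FRAMING (cell charter, verbatim): «discharging `BetaPertH` makes Bałaban's UV stability UNCONDITIONAL — a real constructive-QFT result; it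
is NOT the continuum limit and NOT the Clay problem.»  THIS MODULE DISCHARGES NOTHING of `BetaPertH` ∕ row D1 and NOT the END wrapper's (K1): it is the right-side
fold the road's instantiation lines read (SPEC-51 §F∕§G), [folklore] Fubini ∕ re-indexing BY NAME over the row's OWN objects — the column `colN` of `AN R j` (PART 21∕22∕24),
lit `BalabanStepJets.lamCoeffOf ∕ lamCoeffOf_translate` at `OneStepResolventKernel.shiftK_KInv`, F6a `CompositeVertexKernelRec.compLinKer ∕ compLinKer_sh ∕ compLinKer_eq_zero ∕
abs_compLinKer_le`, F6a‴ `CompositeVertexKernelLiftContract.summable_uncurry_pullback`, GAN24 `TaylorLamBracket.summable_lamCoeffOf_yy ∕ exists_abs_lamCoeffOf_KInv_le`,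
road FP `KernelPeriodisationFib.perF_apply` + `KernelPeriodisationFibTrace.tsum_sites_eq_sum_tsum`, `NVertexSectorsPeriodised.AN_translate_invariant`, PART 24
`translate_wrap_eq`.  0 `def`, 0 `def … : Prop`, 0 sorry, nothing cited; no table VALUE, no estimate.  NOT (C1), NOT the wrapper's (K1), NOT D1, NEVER «G-an2-4 closed»,
NOT BetaPertH, NOT continuum, NOT Clay.

WHAT (all [folklore]; `L = Lc^(j+1)`, `R : Roots Lc`, `j : ℕ`, `colN κ′ u := (AN R j) u (L•y₀) (inl κ′) (inr μ₀)`, `ℓ _ := symLinKerAt (toSite R.r) Lc`,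
`cf κ s κ′ u := Σ_ν Σ'_w lamCoeffOf (KInv L) L ν w κ′ u·compLinKer ℓ Lc j (κ,s) (ν,w)`, `λ′ᴿ_j (κ,s) := Σ_ν Σ'_w Λ′_N μ₀ y₀ ν w·compLinKer ℓ Lc j (κ,s) (ν,w)` — all written out):
* §1 `compLinKer_eq_sum_box` (the top `w`-sum is finite: F6a″'s upper box), `cf_eq_sum_box`, `exists_abs_cf_le` (bounded, uniformly in the column index), `summable_col_mul_cf`,
  **`lamR_eq_tsum_col_mul_cf`** (`λ′ᴿ_j (κ,s) = Σ_{κ′} Σ'_u colN κ′ u·cf κ s κ′ u` — the transported response is the column contracted with the transported coefficient).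
* §2 **`cf_translate_col`** (COVARIANCE: `cf κ s κ′ (translate T u n) = cf κ (translate T′ s (−n)) κ′ u` for `T i = L·T″ i`, `T′ i = Lc^j·T″ i` — lit `lamCoeffOf_translate`
  at `shiftK_KInv`, then F6a `compLinKer_sh` at `symLinKerAt_add`), `summable_cf_slot` ∕ `summable_cf_translate` (the slot-periodisation of `cf` converges — F6a‴
  `summable_uncurry_pullback` at the weight `w ↦ lamCoeffOf … ν w κ′ u`, GAN24 `summable_lamCoeffOf_yy`).
* §3 `perF_AN_col_eq_tsum` (`perF T (AN R j) (ā♭, (wrapPt T (L•y₀), inr μ₀)) = Σ'_n colN ā.2 (translate T ā.1 n)`), `tsum_tsum_mul_sub_eq` (ONE Fubini on `ℤ⁴ × ℤ⁴`: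
  `Σ'_m Σ'_n a n·b (m − n) = (Σ' a)·(Σ' b)` for ℓ¹ `a, b`), **`sum_perF_AN_mul_periodised_cf_eq`** — (J-Λ-fold), `γ = 1`; `…_tower` on the wrapper's tori.

HONEST DEPENDENCY (verbatim): «continuum YM on T⁴ ⇐ BetaPertH ∧ nine spine estimates (0/9 proved); BetaPertH ⇐ (D1) ∧ (D4) ∧ CAP+tail;
G-an2-4 gates asym, D1 and NE2/3/4.»  ABSOLUTE RULE (cell, verbatim): «No internally-minted statement may enter as a cited fact. Every
hypothesis is either kernel-proved in this package or a verbatim quotation of a PUBLISHED theorem with page reference.»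
Unit `b2b-balaban-beta-an2` gen 63 (row-D1 owner), 2026-08-27; `bears_on: R4-O/T1|T1a` (a (C1)-side identity behind the displayed row (K1); moves no node counter).
No existing file touched.
-/

noncomputable section

open scoped BigOperators

namespace Summit.QuantumFields.BalabanUV.Beta.NVertexLamFold

open Finset
open Literature.MathematicalPhysics.QuantumFieldTheory
open Literature.MathematicalPhysics.QuantumFieldTheory.Balaban1983to89
open Literature.MathematicalPhysics.QuantumFieldTheory.Balaban1983to89.Beta
open B4TorusKernel.MultiPeriod (translate)
open B4Reflection242 (translate_translate)
open B5Prop11Plancherel (fine)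
open B6Lemma24Torus (pbox wrap)
open AffineAveraging (Form1 Site box toSite)
open AveragingHessianKernels (Bond ell)
open ExpKernelCalculus (MKer Decays)
open OneStepResolventKernel (Fib KInv shiftK_KInv)
open BalabanStepJets (lamCoeffOf lamCoeffOf_translate)
open KKTFluctuationEnergy (summable_mul_of_bdd summable_mul_of_bdd')
open Summit.QuantumFields.BalabanUV.Beta.AxialDressingRooted (one_le_of_neZero)
open Summit.QuantumFields.BalabanUV.Beta.SymAveragingHessianCounts (symLinKerAt symLinKerAt_add abs_symLinKerAt_le)
open Summit.QuantumFields.BalabanUV.Beta.CompositeVertexKernelRec (compLinKer compLinKer_sh compLinKer_eq_zero abs_compLinKer_le wid)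
open Summit.QuantumFields.BalabanUV.Beta.CompositeVertexKernelLiftKernel (mem_piFinset_of_mem_winF)
open Summit.QuantumFields.BalabanUV.Beta.CompositeVertexKernelLiftContract (summable_uncurry_pullback)
open Summit.QuantumFields.BalabanUV.Beta.CompositeOneShotJetData (Roots AN)
open Summit.QuantumFields.BalabanUV.Beta.NVertexSectorsPeriodised (AN_translate_invariant)
open Summit.QuantumFields.BalabanUV.Beta.GAN24.TaylorLamBracket (summable_lamCoeffOf_yy exists_abs_lamCoeffOf_KInv_le)
open Summit.QuantumFields.BalabanUV.Beta.FP.KernelPeriodisationFib (Idx perF perF_apply perZ_apply)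
open Summit.QuantumFields.BalabanUV.Beta.FP.KernelPeriodisationFibTrace (tsum_sites_eq_sum_tsum)
open Summit.QuantumFields.BalabanUV.Beta.FP.TorusCompositeObjects (towerTorus towerTorus_apply)
open Summit.QuantumFields.BalabanUV.Beta.FP.TorusGaugeCovariancePairing (wrapPt wrapPt_coe)
open Summit.QuantumFields.BalabanUV.Beta.GAN24.KernelPeriodisation (quo)
open Summit.QuantumFields.BalabanUV.Beta.NVertexLamCorePeriodised (towerTorus_fine_apply_eq)
open Summit.QuantumFields.BalabanUV.Beta.NVertexLamStraightPullback (summable_AN_col)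
open Summit.QuantumFields.BalabanUV.Beta.NVertexColumnK1RowTorus (translate_wrap_eq)

variable {Lc : ℕ} [NeZero Lc] (R : Roots Lc) (j : ℕ)

/-! ## §1 The transported coefficient; the transported response is the column contracted with it -/

section Coefficient

/-- [folklore] the top `w`-sum of the composite linear kernel over a fixed lower slot is FINITE: it runs over F6a″'s upper box (terms off the box vanish: `compLinKer_eq_zero`). -/
theorem tsum_mul_compLinKer_eq_sum_box (m : ℕ) (F : Site (3 + 1) → ℝ) (κ ν : Fin (3 + 1)) (s : Site (3 + 1)) :
    (∑' w : Site (3 + 1), F w * compLinKer (fun _ => symLinKerAt (toSite R.r) Lc) Lc m (κ, s) (ν, w))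
      = ∑ w ∈ Fintype.piFinset (fun i => Finset.Icc ((s i - (wid Lc m : ℤ)) / ((Lc ^ m : ℕ) : ℤ)) (s i / ((Lc ^ m : ℕ) : ℤ))),
          F w * compLinKer (fun _ => symLinKerAt (toSite R.r) Lc) Lc m (κ, s) (ν, w) :=
  tsum_eq_sum fun w hw => by
    rw [compLinKer_eq_zero m (f := (κ, s)) (g := (ν, w))
      (fun h => hw (mem_piFinset_of_mem_winF (pow_pos (Nat.pos_of_ne_zero (NeZero.ne Lc)) m) h)), mul_zero]

/-- [folklore] **`exists_abs_cf_le` — THE TRANSPORTED COEFFICIENT IS BOUNDED**, uniformly in the column index `(κ′, u)`, for each lower slot `(κ, s)`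
(finite upper box × bounded `lamCoeffOf` (GAN24 `exists_abs_lamCoeffOf_KInv_le`) × bounded `compLinKer` (F6a `abs_compLinKer_le`)). -/
theorem exists_abs_cf_le (κ : Fin (3 + 1)) (s : Site (3 + 1)) :
    ∃ B : ℝ, ∀ (κ' : Fin (3 + 1)) (u : Site (3 + 1)),
      |∑ ν : Fin (3 + 1), ∑' w : Site (3 + 1), lamCoeffOf (KInv (N := Lc ^ (j + 1)) (d := 3)) (Lc ^ (j + 1)) ν w κ' u
          * compLinKer (fun _ => symLinKerAt (toSite R.r) Lc) Lc j (κ, s) (ν, w)| ≤ B := by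
  obtain ⟨CΛ, hCΛ, hΛ⟩ := exists_abs_lamCoeffOf_KInv_le (N := Lc ^ (j + 1)) (d := 3)
  have hL1 : 1 ≤ Lc := one_le_of_neZero Lc
  set W := Fintype.piFinset (fun i => Finset.Icc ((s i - (wid Lc j : ℤ)) / ((Lc ^ j : ℕ) : ℤ)) (s i / ((Lc ^ j : ℕ) : ℤ))) with hW
  set CB : ℝ := ((((3 : ℕ) : ℝ) + 1) * (2 * (Lc : ℝ)) ^ (3 + 1) * (ell (3 + 1) Lc : ℝ)) ^ j with hCB
  refine ⟨((3 + 1 : ℕ) : ℝ) * (W.card * (CΛ * CB)), fun κ' u => ?_⟩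
  have hterm : ∀ ν : Fin (3 + 1), |∑' w : Site (3 + 1), lamCoeffOf (KInv (N := Lc ^ (j + 1)) (d := 3)) (Lc ^ (j + 1)) ν w κ' u
      * compLinKer (fun _ => symLinKerAt (toSite R.r) Lc) Lc j (κ, s) (ν, w)| ≤ W.card * (CΛ * CB) := by
    intro ν
    rw [tsum_mul_compLinKer_eq_sum_box R j (fun w => lamCoeffOf (KInv (N := Lc ^ (j + 1)) (d := 3)) (Lc ^ (j + 1)) ν w κ' u) κ ν s, ← hW]
    refine (abs_sum_le_sum_abs _ _).trans ((sum_le_sum fun w _ => ?_).trans (by rw [sum_const, nsmul_eq_mul]))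
    rw [abs_mul]
    exact mul_le_mul (hΛ ν w κ' u) (abs_compLinKer_le (ℓ := fun _ => symLinKerAt (toSite R.r) Lc) (L := Lc)
      (by positivity) (fun _ μ' y' g => abs_symLinKerAt_le hL1 μ' y' R.hr g) j (κ, s) (ν, w)) (abs_nonneg _) hCΛ
  refine (abs_sum_le_sum_abs _ _).trans ((sum_le_sum fun ν _ => hterm ν).trans ?_)
  rw [sum_const, card_univ, Fintype.card_fin, nsmul_eq_mul]

/-- [folklore] the column contracted with the transported coefficient converges: `u ↦ colN κ′ u·cf κ s κ′ u` is summable (`summable_AN_col` × bounded). -/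
theorem summable_col_mul_cf (μ₀ κ κ' : Fin (3 + 1)) (y₀ s : Site (3 + 1)) :
    Summable fun u : Site (3 + 1) => AN R j u (((Lc ^ (j + 1) : ℕ) : ℤ) • y₀) (Sum.inl κ') (Sum.inr μ₀)
      * ∑ ν : Fin (3 + 1), ∑' w : Site (3 + 1), lamCoeffOf (KInv (N := Lc ^ (j + 1)) (d := 3)) (Lc ^ (j + 1)) ν w κ' u
          * compLinKer (fun _ => symLinKerAt (toSite R.r) Lc) Lc j (κ, s) (ν, w) := by
  obtain ⟨B, hB⟩ := exists_abs_cf_le R j κ s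
  exact summable_mul_of_bdd' (summable_AN_col R j μ₀ κ' y₀) (fun u => hB κ' u)

/-- [folklore] **`lamR_eq_tsum_col_mul_cf` — THE TRANSPORTED RESPONSE IS THE COLUMN CONTRACTED WITH THE TRANSPORTED COEFFICIENT**:
`λ′ᴿ_j (κ,s) = Σ_{κ′} Σ'_u colN κ′ u·cf κ s κ′ u` (the top `w`-slice is finite for fixed `(κ,s)`, so only convergent `u`-sums are exchanged with finite sums). -/
theorem lamR_eq_tsum_col_mul_cf (μ₀ κ : Fin (3 + 1)) (y₀ s : Site (3 + 1)) :
    (∑ ν : Fin (3 + 1), ∑' w : Site (3 + 1),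
        (∑ κ' : Fin (3 + 1), ∑' u : Site (3 + 1),
            AN R j u (((Lc ^ (j + 1) : ℕ) : ℤ) • y₀) (Sum.inl κ') (Sum.inr μ₀) * lamCoeffOf (KInv (N := Lc ^ (j + 1)) (d := 3)) (Lc ^ (j + 1)) ν w κ' u)
          * compLinKer (fun _ => symLinKerAt (toSite R.r) Lc) Lc j (κ, s) (ν, w))
      = ∑ κ' : Fin (3 + 1), ∑' u : Site (3 + 1), AN R j u (((Lc ^ (j + 1) : ℕ) : ℤ) • y₀) (Sum.inl κ') (Sum.inr μ₀)
          * ∑ ν : Fin (3 + 1), ∑' w : Site (3 + 1), lamCoeffOf (KInv (N := Lc ^ (j + 1)) (d := 3)) (Lc ^ (j + 1)) ν w κ' u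
              * compLinKer (fun _ => symLinKerAt (toSite R.r) Lc) Lc j (κ, s) (ν, w) := by
  obtain ⟨CΛ, -, hΛ⟩ := exists_abs_lamCoeffOf_KInv_le (N := Lc ^ (j + 1)) (d := 3)
  set W := Fintype.piFinset (fun i => Finset.Icc ((s i - (wid Lc j : ℤ)) / ((Lc ^ j : ℕ) : ℤ)) (s i / ((Lc ^ j : ℕ) : ℤ))) with hW
  have hsum : ∀ (κ' ν : Fin (3 + 1)) (w : Site (3 + 1)), Summable fun u : Site (3 + 1) =>
      AN R j u (((Lc ^ (j + 1) : ℕ) : ℤ) • y₀) (Sum.inl κ') (Sum.inr μ₀) * lamCoeffOf (KInv (N := Lc ^ (j + 1)) (d := 3)) (Lc ^ (j + 1)) ν w κ' u :=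
    fun κ' ν w => summable_mul_of_bdd' (summable_AN_col R j μ₀ κ' y₀) (fun u => hΛ ν w κ' u)
  -- left: the finite `w`-box, the finite `κ'`-sum and the `u`-sum exchanged
  calc (∑ ν : Fin (3 + 1), ∑' w : Site (3 + 1),
        (∑ κ' : Fin (3 + 1), ∑' u : Site (3 + 1),
            AN R j u (((Lc ^ (j + 1) : ℕ) : ℤ) • y₀) (Sum.inl κ') (Sum.inr μ₀) * lamCoeffOf (KInv (N := Lc ^ (j + 1)) (d := 3)) (Lc ^ (j + 1)) ν w κ' u)
          * compLinKer (fun _ => symLinKerAt (toSite R.r) Lc) Lc j (κ, s) (ν, w))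
      = ∑ ν : Fin (3 + 1), ∑ w ∈ W, ∑ κ' : Fin (3 + 1), ∑' u : Site (3 + 1),
          AN R j u (((Lc ^ (j + 1) : ℕ) : ℤ) • y₀) (Sum.inl κ') (Sum.inr μ₀) * (lamCoeffOf (KInv (N := Lc ^ (j + 1)) (d := 3)) (Lc ^ (j + 1)) ν w κ' u
            * compLinKer (fun _ => symLinKerAt (toSite R.r) Lc) Lc j (κ, s) (ν, w)) := by
        refine sum_congr rfl fun ν _ => ?_
        rw [tsum_mul_compLinKer_eq_sum_box R j _ κ ν s, ← hW]
        refine sum_congr rfl fun w _ => ?_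
        rw [Finset.sum_mul]
        refine sum_congr rfl fun κ' _ => ?_
        rw [← tsum_mul_right]
        exact tsum_congr fun u => by ring
    _ = ∑ κ' : Fin (3 + 1), ∑' u : Site (3 + 1), ∑ ν : Fin (3 + 1), ∑ w ∈ W,
          AN R j u (((Lc ^ (j + 1) : ℕ) : ℤ) • y₀) (Sum.inl κ') (Sum.inr μ₀) * (lamCoeffOf (KInv (N := Lc ^ (j + 1)) (d := 3)) (Lc ^ (j + 1)) ν w κ' u
            * compLinKer (fun _ => symLinKerAt (toSite R.r) Lc) Lc j (κ, s) (ν, w)) := by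
        have hs : ∀ (κ' ν : Fin (3 + 1)) (w : Site (3 + 1)), Summable fun u : Site (3 + 1) =>
            AN R j u (((Lc ^ (j + 1) : ℕ) : ℤ) • y₀) (Sum.inl κ') (Sum.inr μ₀) * (lamCoeffOf (KInv (N := Lc ^ (j + 1)) (d := 3)) (Lc ^ (j + 1)) ν w κ' u
              * compLinKer (fun _ => symLinKerAt (toSite R.r) Lc) Lc j (κ, s) (ν, w)) := fun κ' ν w =>
          ((hsum κ' ν w).mul_right (compLinKer (fun _ => symLinKerAt (toSite R.r) Lc) Lc j (κ, s) (ν, w))).congr fun u => by ring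
        have stepA : ∀ ν : Fin (3 + 1), (∑ w ∈ W, ∑ κ' : Fin (3 + 1), ∑' u : Site (3 + 1),
            AN R j u (((Lc ^ (j + 1) : ℕ) : ℤ) • y₀) (Sum.inl κ') (Sum.inr μ₀) * (lamCoeffOf (KInv (N := Lc ^ (j + 1)) (d := 3)) (Lc ^ (j + 1)) ν w κ' u
              * compLinKer (fun _ => symLinKerAt (toSite R.r) Lc) Lc j (κ, s) (ν, w)))
            = ∑ κ' : Fin (3 + 1), ∑' u : Site (3 + 1), ∑ w ∈ W,
              AN R j u (((Lc ^ (j + 1) : ℕ) : ℤ) • y₀) (Sum.inl κ') (Sum.inr μ₀) * (lamCoeffOf (KInv (N := Lc ^ (j + 1)) (d := 3)) (Lc ^ (j + 1)) ν w κ' u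
                * compLinKer (fun _ => symLinKerAt (toSite R.r) Lc) Lc j (κ, s) (ν, w)) := fun ν => by
          rw [Finset.sum_comm]
          exact Finset.sum_congr rfl fun κ' _ => (Summable.tsum_finsetSum fun w _ => hs κ' ν w).symm
        rw [Finset.sum_congr rfl fun ν _ => stepA ν, Finset.sum_comm]
        refine Finset.sum_congr rfl fun κ' _ => ?_
        rw [← Summable.tsum_finsetSum fun ν _ => summable_sum fun w _ => hs κ' ν w]
    _ = _ := by
        refine sum_congr rfl fun κ' _ => tsum_congr fun u => ?_
        rw [Finset.mul_sum]
        refine sum_congr rfl fun ν _ => ?_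
        rw [tsum_mul_compLinKer_eq_sum_box R j _ κ ν s, ← hW, Finset.mul_sum]

end Coefficient

/-! ## §2 Covariance of the transported coefficient under the period lattices; its slot-periodisation converges -/

section Covariance

variable (T T' T'' : Fin (3 + 1) → ℕ) (hT : ∀ i, T i = Lc * T' i) (hT' : ∀ i, T' i = Lc ^ j * T'' i)
include hT hT'

omit [NeZero Lc] in
/-- [folklore] the fine torus is `L·T″`, `L = Lc^(j+1)`. -/
theorem torus_eq_mul (i : Fin (3 + 1)) : (T i : ℤ) = ((Lc ^ (j + 1) : ℕ) : ℤ) * (T'' i : ℤ) := by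
  rw [hT i, hT' i]; push_cast; ring

/-- [folklore] **`cf_translate_col` — COVARIANCE OF THE TRANSPORTED COEFFICIENT**: shifting the column index by the fine period `T•n` shifts the lower slot by `−T′•n`:
`cf κ s κ′ (translate T u n) = cf κ (translate T′ s (−n)) κ′ u` (lit `lamCoeffOf_translate` at `shiftK_KInv`: `T•n = L•(T″•n)` moves the top slot by `T″•n`; F6a
`compLinKer_sh` at `symLinKerAt_add`: a top-slot shift by `t` is a bottom-slot shift by `Lc^j•t = T′•n`). -/
theorem cf_translate_col (κ κ' : Fin (3 + 1)) (s u n : Site (3 + 1)) :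
    (∑ ν : Fin (3 + 1), ∑' w : Site (3 + 1), lamCoeffOf (KInv (N := Lc ^ (j + 1)) (d := 3)) (Lc ^ (j + 1)) ν w κ' (translate T u n)
        * compLinKer (fun _ => symLinKerAt (toSite R.r) Lc) Lc j (κ, s) (ν, w))
      = ∑ ν : Fin (3 + 1), ∑' w : Site (3 + 1), lamCoeffOf (KInv (N := Lc ^ (j + 1)) (d := 3)) (Lc ^ (j + 1)) ν w κ' u
        * compLinKer (fun _ => symLinKerAt (toSite R.r) Lc) Lc j (κ, translate T' s (-n)) (ν, w) := by
  set t : Site (3 + 1) := fun i => (T'' i : ℤ) * n i with ht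
  have hu : translate T u n = u + ((Lc ^ (j + 1) : ℕ) : ℤ) • t := by
    funext i
    simp only [B4TorusKernel.MultiPeriod.translate_apply, Pi.add_apply, Pi.smul_apply, smul_eq_mul, ht, torus_eq_mul j T T' T'' hT hT' i]
    ring
  refine sum_congr rfl fun ν _ => ?_
  -- move the top slot: `lam ν w κ′ (u + L•t) = lam ν (w − t) κ′ u`, then re-index `w ↦ w + t`
  have h1 : ∀ w : Site (3 + 1), lamCoeffOf (KInv (N := Lc ^ (j + 1)) (d := 3)) (Lc ^ (j + 1)) ν w κ' (translate T u n)
      = lamCoeffOf (KInv (N := Lc ^ (j + 1)) (d := 3)) (Lc ^ (j + 1)) ν (w - t) κ' u := fun w => by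
    rw [hu, show w = (w - t) + t from (sub_add_cancel w t).symm, lamCoeffOf_translate (shiftK_KInv (N := Lc ^ (j + 1))), sub_add_cancel]
  simp_rw [h1]
  rw [← (Equiv.addRight t).tsum_eq fun w => lamCoeffOf (KInv (N := Lc ^ (j + 1)) (d := 3)) (Lc ^ (j + 1)) ν (w - t) κ' u
    * compLinKer (fun _ => symLinKerAt (toSite R.r) Lc) Lc j (κ, s) (ν, w)]
  refine tsum_congr fun w => ?_
  simp only [Equiv.coe_addRight, add_sub_cancel_right]
  congr 1
  -- the composite kernel's covariance: top slot `+t`, bottom slot `+Lc^j•t = +T′•n`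
  have hsh := compLinKer_sh (ℓ := fun _ => symLinKerAt (toSite R.r) Lc) (L := Lc) (fun _ μ' y' t' f => symLinKerAt_add (toSite R.r) Lc μ' y' t' f)
    j (κ, translate T' s (-n)) (ν, w) t
  have hb : Bond.sh ((κ, translate T' s (-n)) : Bond (3 + 1)) (((Lc : ℤ) ^ j) • t) = (κ, s) := by
    unfold Bond.sh
    refine Prod.ext rfl ?_
    funext i
    simp only [Pi.add_apply, Pi.smul_apply, smul_eq_mul, B4TorusKernel.MultiPeriod.translate_apply, ht, hT' i, Pi.neg_apply]
    push_cast; ring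
  have hg : Bond.sh ((ν, w) : Bond (3 + 1)) t = (ν, w + t) := rfl
  rw [hb, hg] at hsh
  exact hsh

omit hT hT' in
/-- [folklore] **the transported coefficient is summable in its lower slot** (F6a‴ `summable_uncurry_pullback` at the top weight `w ↦ lamCoeffOf … ν w κ′ u`, summable by GAN24
`summable_lamCoeffOf_yy`; the bricks bounded by `abs_symLinKerAt_le`). -/
theorem summable_cf_slot (κ κ' : Fin (3 + 1)) (u : Site (3 + 1)) :
    Summable fun s : Site (3 + 1) => ∑ ν : Fin (3 + 1), ∑' w : Site (3 + 1), lamCoeffOf (KInv (N := Lc ^ (j + 1)) (d := 3)) (Lc ^ (j + 1)) ν w κ' u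
        * compLinKer (fun _ => symLinKerAt (toSite R.r) Lc) Lc j (κ, s) (ν, w) := by
  have hL1 : 1 ≤ Lc := one_le_of_neZero Lc
  refine summable_sum fun ν _ => ?_
  have h := (summable_uncurry_pullback (ℓ := fun _ => symLinKerAt (toSite R.r) Lc) (L := Lc) (F := fun _ _ => (1 : ℝ)) (BF := 1)
    (by positivity : (0 : ℝ) ≤ (ell (3 + 1) Lc : ℝ)) (fun _ μ' y' g => abs_symLinKerAt_le hL1 μ' y' R.hr g) (fun _ _ => by rw [abs_one]) 0 j
    (summable_lamCoeffOf_yy (N' := Lc ^ (j + 1)) (d := 3) ν κ' u) κ ν).prod_symm.prod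
  refine h.congr fun s => tsum_congr fun w => ?_
  dsimp only [Function.uncurry, Prod.swap]
  rw [mul_one]

omit hT hT' in
/-- [folklore] … hence its slot-PERIODISATION over any torus `T′` with `1 ≤ T′ i` converges. -/
theorem summable_cf_translate (hT1 : ∀ i, 1 ≤ T' i) (κ κ' : Fin (3 + 1)) (s u : Site (3 + 1)) :
    Summable fun m : Site (3 + 1) => ∑ ν : Fin (3 + 1), ∑' w : Site (3 + 1), lamCoeffOf (KInv (N := Lc ^ (j + 1)) (d := 3)) (Lc ^ (j + 1)) ν w κ' u
        * compLinKer (fun _ => symLinKerAt (toSite R.r) Lc) Lc j (κ, translate T' s m) (ν, w) :=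
  (summable_cf_slot R j κ κ' u).comp_injective (B4TorusKernel.MultiPeriod.translate_injective hT1 s)

end Covariance

/-! ## §3 The fold -/

section Fold

variable (T : Fin (3 + 1) → ℕ) [∀ i, NeZero (T i)]

/-- [folklore] **the torus column is the fine-index periodisation of the lattice column**: for `Lc^(j+1) ∣ T i`,
`perF T (AN R j) (ā♭, (wrapPt T (L•y₀), inr μ₀)) = Σ'_n colN ā.2 (translate T ā.1 n)` (`perF_apply`, PART 24 `translate_wrap_eq`, `AN_translate_invariant`, re-indexing). -/
theorem perF_AN_col_eq_tsum (hT : ∀ i, Lc ^ (j + 1) ∣ T i) (μ₀ : Fin (3 + 1)) (y₀ : Site (3 + 1)) (a : ↥(pbox T) × Fin (3 + 1)) :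
    perF T (AN R j) (a.1, Sum.inl a.2) (wrapPt T (((Lc ^ (j + 1) : ℕ) : ℤ) • y₀), Sum.inr μ₀)
      = ∑' n : Site (3 + 1), AN R j (translate T (a.1 : Site (3 + 1)) n) (((Lc ^ (j + 1) : ℕ) : ℤ) • y₀) (Sum.inl a.2) (Sum.inr μ₀) := by
  rw [perF_apply, perZ_apply, wrapPt_coe]
  rw [← (Equiv.subLeft (quo T (((Lc ^ (j + 1) : ℕ) : ℤ) • y₀))).tsum_eq
    fun n => AN R j (translate T (a.1 : Site (3 + 1)) n) (((Lc ^ (j + 1) : ℕ) : ℤ) • y₀) (Sum.inl a.2) (Sum.inr μ₀)]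
  refine tsum_congr fun m => ?_
  rw [translate_wrap_eq, Equiv.subLeft_apply,
    ← AN_translate_invariant R j (M := T) hT (quo T (((Lc ^ (j + 1) : ℕ) : ℤ) • y₀) - m) (a.1 : Site (3 + 1))
      (translate T (((Lc ^ (j + 1) : ℕ) : ℤ) • y₀) (m - quo T (((Lc ^ (j + 1) : ℕ) : ℤ) • y₀))), translate_translate]
  congr 2
  rw [show m - quo T (((Lc ^ (j + 1) : ℕ) : ℤ) • y₀) + (quo T (((Lc ^ (j + 1) : ℕ) : ℤ) • y₀) - m) = 0 by abel]
  funext i; simp only [B4TorusKernel.MultiPeriod.translate_apply, Pi.zero_apply, mul_zero, add_zero]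

omit [NeZero Lc] in
omit [NeZero Lc] in
/-- [folklore] the sheared product of two summable real families on `ℤ⁴` is summable in the outer index: `m ↦ Σ'_n a n·b (m − n)`. -/
theorem summable_tsum_mul_sub {a b : Site (3 + 1) → ℝ} (ha : Summable a) (hb : Summable b) :
    Summable fun m : Site (3 + 1) => ∑' n : Site (3 + 1), a n * b (m - n) := by
  have hprod : Summable fun p : Site (3 + 1) × Site (3 + 1) => a p.1 * b p.2 :=
    summable_mul_of_summable_norm (f := a) (g := b) (by simpa only [Real.norm_eq_abs] using ha.abs) (by simpa only [Real.norm_eq_abs] using hb.abs)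
  have hshear : Summable fun p : Site (3 + 1) × Site (3 + 1) => a p.1 * b (p.2 - p.1) := by
    have := ((Equiv.prodShear (Equiv.refl _) (fun n => Equiv.subRight n)).summable_iff
      (f := fun p : Site (3 + 1) × Site (3 + 1) => a p.1 * b p.2)).2 hprod
    refine this.congr fun p => ?_
    simp only [Function.comp, Equiv.prodShear_apply, Equiv.refl_apply, Equiv.subRight_apply]
  exact hshear.prod_symm.prod

/-- [folklore] **ONE FUBINI ON `ℤ⁴ × ℤ⁴`**: for summable real `a, b`, `Σ'_m Σ'_n a n·b (m − n) = (Σ' a)·(Σ' b)` (absolute convergence from `Summable.abs`; the shear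
`(n, m) ↦ (n, m − n)`; `tsum_mul_left ∕ _right`). -/
theorem tsum_tsum_mul_sub_eq {a b : Site (3 + 1) → ℝ} (ha : Summable a) (hb : Summable b) :
    (∑' m : Site (3 + 1), ∑' n : Site (3 + 1), a n * b (m - n)) = (∑' n, a n) * ∑' m, b m := by
  -- the product family on `ℤ⁴ × ℤ⁴` and its shear
  have hprod : Summable fun p : Site (3 + 1) × Site (3 + 1) => a p.1 * b p.2 :=
    summable_mul_of_summable_norm (f := a) (g := b) (by simpa only [Real.norm_eq_abs] using ha.abs) (by simpa only [Real.norm_eq_abs] using hb.abs)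
  set e : Site (3 + 1) × Site (3 + 1) ≃ Site (3 + 1) × Site (3 + 1) := Equiv.prodShear (Equiv.refl _) (fun n => Equiv.subRight n) with he
  have hshear : Summable fun p : Site (3 + 1) × Site (3 + 1) => a p.1 * b (p.2 - p.1) := by
    have := (e.summable_iff (f := fun p : Site (3 + 1) × Site (3 + 1) => a p.1 * b p.2)).2 hprod
    refine this.congr fun p => ?_
    simp only [he, Function.comp, Equiv.prodShear_apply, Equiv.refl_apply, Equiv.subRight_apply]
  -- `Σ'_m Σ'_n f n m = Σ'_n Σ'_m f n m`
  have h1 : ∀ n : Site (3 + 1), Summable fun m : Site (3 + 1) => a n * b (m - n) := fun n =>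
    ((Equiv.subRight n).summable_iff.2 hb).mul_left (a n)
  have h2 : ∀ m : Site (3 + 1), Summable fun n : Site (3 + 1) => a n * b (m - n) := fun m => hshear.prod_symm.prod_factor m
  have hswap : (∑' m : Site (3 + 1), ∑' n : Site (3 + 1), a n * b (m - n)) = ∑' n : Site (3 + 1), ∑' m : Site (3 + 1), a n * b (m - n) :=
    Summable.tsum_comm' (f := fun n m => a n * b (m - n)) hshear h1 h2
  rw [hswap]
  have hinner : ∀ n : Site (3 + 1), (∑' m : Site (3 + 1), a n * b (m - n)) = a n * ∑' m, b m := fun n => by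
    rw [tsum_mul_left]
    exact congrArg (a n * ·) ((Equiv.subRight n).tsum_eq b)
  rw [tsum_congr hinner, tsum_mul_right]

/-- [folklore] **the slot-translated transported response, folded over the fine torus**: for `T i = Lc·T′ i`, `T′ i = Lc^j·T″ i` and every period index `m`,
`λ′ᴿ_j (κ, translate T′ s m) = Σ_{ā : pbox T × Fin 4} Σ'_n colN ā.2 (translate T ā.1 n)·cf κ (translate T′ s (m − n)) ā.2 ā.1` (§1's contraction, the `u`-sum folded over
the torus — road FP `tsum_sites_eq_sum_tsum` —, §2's covariance). -/
theorem lamR_translate_eq_sum_tsum (T' T'' : Fin (3 + 1) → ℕ) (hT : ∀ i, T i = Lc * T' i) (hT' : ∀ i, T' i = Lc ^ j * T'' i)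
    (μ₀ κ : Fin (3 + 1)) (y₀ s m : Site (3 + 1)) :
    (∑ ν : Fin (3 + 1), ∑' w : Site (3 + 1),
        (∑ κ' : Fin (3 + 1), ∑' u : Site (3 + 1),
            AN R j u (((Lc ^ (j + 1) : ℕ) : ℤ) • y₀) (Sum.inl κ') (Sum.inr μ₀) * lamCoeffOf (KInv (N := Lc ^ (j + 1)) (d := 3)) (Lc ^ (j + 1)) ν w κ' u)
          * compLinKer (fun _ => symLinKerAt (toSite R.r) Lc) Lc j (κ, translate T' s m) (ν, w))
      = ∑ a : ↥(pbox T) × Fin (3 + 1), ∑' n : Site (3 + 1),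
          AN R j (translate T (a.1 : Site (3 + 1)) n) (((Lc ^ (j + 1) : ℕ) : ℤ) • y₀) (Sum.inl a.2) (Sum.inr μ₀)
            * ∑ ν : Fin (3 + 1), ∑' w : Site (3 + 1), lamCoeffOf (KInv (N := Lc ^ (j + 1)) (d := 3)) (Lc ^ (j + 1)) ν w a.2 (a.1 : Site (3 + 1))
                * compLinKer (fun _ => symLinKerAt (toSite R.r) Lc) Lc j (κ, translate T' s (m - n)) (ν, w) := by
  rw [lamR_eq_tsum_col_mul_cf R j μ₀ κ y₀ (translate T' s m), Fintype.sum_prod_type_right]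
  refine sum_congr rfl fun κ' _ => ?_
  rw [tsum_sites_eq_sum_tsum (M := T) (summable_col_mul_cf R j μ₀ κ κ' y₀ (translate T' s m))]
  refine sum_congr rfl fun x _ => tsum_congr fun n => ?_
  rw [cf_translate_col R j T T' T'' hT hT' κ κ' (translate T' s m) (x : Site (3 + 1)) n, translate_translate, ← sub_eq_add_neg]

/-- [folklore] **`sum_perF_AN_mul_periodised_cf_eq` — (J-Λ-fold), `γ = 1`**: for tori `T i = Lc·T′ i`, `T′ i = Lc^j·T″ i` (`L = Lc^(j+1)`), every source `(μ₀, y₀)` and every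
lower slot `(κ, s)`:
`Σ_{ā : pbox T × Fin 4} perF T (AN R j) (ā♭, (wrapPt T (L•y₀), inr μ₀))·(Σ'_m cf κ (translate T′ s m) ā.2 ā.1) = Σ'_m λ′ᴿ_j (κ, translate T′ s m)` —
THE TORUS COLUMN TIMES THE SLOT-PERIODISED TRANSPORTED COEFFICIENT, SUMMED OVER THE TORUS BONDS, IS THE SLOT-PERIODISED TRANSPORTED RESPONSE. -/
theorem sum_perF_AN_mul_periodised_cf_eq (T' T'' : Fin (3 + 1) → ℕ) (hT : ∀ i, T i = Lc * T' i) (hT' : ∀ i, T' i = Lc ^ j * T'' i)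
    (μ₀ κ : Fin (3 + 1)) (y₀ s : Site (3 + 1)) :
    ∑ a : ↥(pbox T) × Fin (3 + 1), perF T (AN R j) (a.1, Sum.inl a.2) (wrapPt T (((Lc ^ (j + 1) : ℕ) : ℤ) • y₀), Sum.inr μ₀)
        * ∑' m : Site (3 + 1), ∑ ν : Fin (3 + 1), ∑' w : Site (3 + 1),
            lamCoeffOf (KInv (N := Lc ^ (j + 1)) (d := 3)) (Lc ^ (j + 1)) ν w a.2 (a.1 : Site (3 + 1))
              * compLinKer (fun _ => symLinKerAt (toSite R.r) Lc) Lc j (κ, translate T' s m) (ν, w)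
      = ∑' m : Site (3 + 1), ∑ ν : Fin (3 + 1), ∑' w : Site (3 + 1),
          (∑ κ' : Fin (3 + 1), ∑' u : Site (3 + 1),
              AN R j u (((Lc ^ (j + 1) : ℕ) : ℤ) • y₀) (Sum.inl κ') (Sum.inr μ₀) * lamCoeffOf (KInv (N := Lc ^ (j + 1)) (d := 3)) (Lc ^ (j + 1)) ν w κ' u)
            * compLinKer (fun _ => symLinKerAt (toSite R.r) Lc) Lc j (κ, translate T' s m) (ν, w) := by
  have hTdvd : ∀ i, Lc ^ (j + 1) ∣ T i := fun i => ⟨T'' i, by rw [hT i, hT' i]; ring⟩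
  have hT1 : ∀ i, 1 ≤ T' i := fun i => Nat.one_le_iff_ne_zero.mpr fun h => by
    have h0 := NeZero.ne (T i); rw [hT i, h, mul_zero] at h0; exact h0 rfl
  -- per torus bond: the two ℓ¹ period sums and their Fubini
  have hsa : ∀ a : ↥(pbox T) × Fin (3 + 1), Summable fun n : Site (3 + 1) =>
      AN R j (translate T (a.1 : Site (3 + 1)) n) (((Lc ^ (j + 1) : ℕ) : ℤ) • y₀) (Sum.inl a.2) (Sum.inr μ₀) := fun a =>
    (summable_AN_col R j μ₀ a.2 y₀).comp_injective (B4TorusKernel.MultiPeriod.translate_injective (fun i => one_le_of_neZero (T i)) _)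
  have hsb : ∀ a : ↥(pbox T) × Fin (3 + 1), Summable fun m : Site (3 + 1) =>
      ∑ ν : Fin (3 + 1), ∑' w : Site (3 + 1), lamCoeffOf (KInv (N := Lc ^ (j + 1)) (d := 3)) (Lc ^ (j + 1)) ν w a.2 (a.1 : Site (3 + 1))
        * compLinKer (fun _ => symLinKerAt (toSite R.r) Lc) Lc j (κ, translate T' s m) (ν, w) := fun a =>
    summable_cf_translate R j T' hT1 κ a.2 s (a.1 : Site (3 + 1))
  -- summability in the period index `m` of the folded right side, bond by bond (no expected type: the lemma's implicit families are read off `hsa ∕ hsb`)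
  have hab := fun a : ↥(pbox T) × Fin (3 + 1) => summable_tsum_mul_sub (hsa a) (hsb a)
  calc ∑ a : ↥(pbox T) × Fin (3 + 1), perF T (AN R j) (a.1, Sum.inl a.2) (wrapPt T (((Lc ^ (j + 1) : ℕ) : ℤ) • y₀), Sum.inr μ₀)
        * ∑' m : Site (3 + 1), ∑ ν : Fin (3 + 1), ∑' w : Site (3 + 1),
            lamCoeffOf (KInv (N := Lc ^ (j + 1)) (d := 3)) (Lc ^ (j + 1)) ν w a.2 (a.1 : Site (3 + 1))
              * compLinKer (fun _ => symLinKerAt (toSite R.r) Lc) Lc j (κ, translate T' s m) (ν, w)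
      = ∑ a : ↥(pbox T) × Fin (3 + 1), ∑' m : Site (3 + 1), ∑' n : Site (3 + 1),
          AN R j (translate T (a.1 : Site (3 + 1)) n) (((Lc ^ (j + 1) : ℕ) : ℤ) • y₀) (Sum.inl a.2) (Sum.inr μ₀)
            * ∑ ν : Fin (3 + 1), ∑' w : Site (3 + 1), lamCoeffOf (KInv (N := Lc ^ (j + 1)) (d := 3)) (Lc ^ (j + 1)) ν w a.2 (a.1 : Site (3 + 1))
                * compLinKer (fun _ => symLinKerAt (toSite R.r) Lc) Lc j (κ, translate T' s (m - n)) (ν, w) := by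
        refine sum_congr rfl fun a _ => ?_
        rw [perF_AN_col_eq_tsum R j T hTdvd μ₀ y₀ a, ← tsum_tsum_mul_sub_eq (hsa a) (hsb a)]
    _ = ∑' m : Site (3 + 1), ∑ a : ↥(pbox T) × Fin (3 + 1), ∑' n : Site (3 + 1),
          AN R j (translate T (a.1 : Site (3 + 1)) n) (((Lc ^ (j + 1) : ℕ) : ℤ) • y₀) (Sum.inl a.2) (Sum.inr μ₀)
            * ∑ ν : Fin (3 + 1), ∑' w : Site (3 + 1), lamCoeffOf (KInv (N := Lc ^ (j + 1)) (d := 3)) (Lc ^ (j + 1)) ν w a.2 (a.1 : Site (3 + 1))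
                * compLinKer (fun _ => symLinKerAt (toSite R.r) Lc) Lc j (κ, translate T' s (m - n)) (ν, w) :=
        (Summable.tsum_finsetSum fun a _ => hab a).symm
    _ = _ := tsum_congr fun m => (lamR_translate_eq_sum_tsum R j T T' T'' hT hT' μ₀ κ y₀ s m).symm

/-- [folklore] **`sum_perF_AN_mul_periodised_cf_eq_tower` — (J-Λ-fold) ON THE WRAPPER's TORI**: `T := towerTorus Lc (fine Lc M) m′` (its `towerTorus Lc (fine Lc (Mc B)) (n+1)`),
`T′ := towerTorus Lc M m′` (its `Ma (n+1)`), `T″ := M` at `m′ = j` (its `Mc B`). -/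
theorem sum_perF_AN_mul_periodised_cf_eq_tower (M : Fin (3 + 1) → ℕ) [∀ i, NeZero (M i)] (μ₀ κ : Fin (3 + 1)) (y₀ s : Site (3 + 1)) :
    ∑ a : ↥(pbox (towerTorus Lc (fine Lc M) j)) × Fin (3 + 1),
        perF (towerTorus Lc (fine Lc M) j) (AN R j) (a.1, Sum.inl a.2) (wrapPt (towerTorus Lc (fine Lc M) j) (((Lc ^ (j + 1) : ℕ) : ℤ) • y₀), Sum.inr μ₀)
          * ∑' m : Site (3 + 1), ∑ ν : Fin (3 + 1), ∑' w : Site (3 + 1),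
              lamCoeffOf (KInv (N := Lc ^ (j + 1)) (d := 3)) (Lc ^ (j + 1)) ν w a.2 (a.1 : Site (3 + 1))
                * compLinKer (fun _ => symLinKerAt (toSite R.r) Lc) Lc j (κ, translate (towerTorus Lc M j) s m) (ν, w)
      = ∑' m : Site (3 + 1), ∑ ν : Fin (3 + 1), ∑' w : Site (3 + 1),
          (∑ κ' : Fin (3 + 1), ∑' u : Site (3 + 1),
              AN R j u (((Lc ^ (j + 1) : ℕ) : ℤ) • y₀) (Sum.inl κ') (Sum.inr μ₀) * lamCoeffOf (KInv (N := Lc ^ (j + 1)) (d := 3)) (Lc ^ (j + 1)) ν w κ' u)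
            * compLinKer (fun _ => symLinKerAt (toSite R.r) Lc) Lc j (κ, translate (towerTorus Lc M j) s m) (ν, w) :=
  sum_perF_AN_mul_periodised_cf_eq R j (towerTorus Lc (fine Lc M) j) (towerTorus Lc M j) M (towerTorus_fine_apply_eq M j)
    (fun i => towerTorus_apply Lc M j i) μ₀ κ y₀ s

end Fold

end Summit.QuantumFields.BalabanUV.Beta.NVertexLamFold

end
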